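import Literature.ModelTheory.ExponentialFields.PilaWilkieLastVariableCk
import Literature.ModelTheory.ExponentialFields.OMinimalDimensionCorollaries
import Literature.ModelTheory.ExponentialFields.PilaWilkieFamilyParametrization
import Literature.ModelTheory.ExponentialFields.PilaWilkieReparamTools
import Literature.ModelTheory.ExponentialFields.PilaWilkieCubeMaps
import HarnessLib

/-!
# The uniform reparametrization in dimension `m + 1` from dimensions `≤ m` (Bhardwaj–van den Dries 2022, §7)

Topic `Literature/ModelTheory/ExponentialFields`; proof file in the cone of the named fact
`PilaWilkie2006_thm_1_8`.  The induction step `(I)_{≤ m} ⇒ (I)_{m+1}` of the o-minimal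
reparametrization theorem (Bhardwaj–van den Dries 2022, §7; Pila–Wilkie 2006, §4–§5), in the
uniform-in-parameters form `UR(k, ℓ)` over `ℝ` used throughout this development:

* tools: `contDiffOn_norm_iteratedFDeriv_comp_proj` (padding charts by a coordinate
  projection), `proj_castLE_surjOn`, `proj_castLE_mapsTo`, `norm_iteratedFDeriv_const_le`,
  `dim_lt_of_interior_eq_empty`, `dim_slice_le`;
* **`uniformReparam_succ`** — `(∀ ℓ ≤ m, UR(k, ℓ)) → UR(k, m + 1)` (`k ≥ 1`): reparametrize
  the sections uniformly in `(v, t)` (`UR(k, m)`), apply Cor. 6.4 (`lastVariable_Ck`) to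
  `F = (φ_j, f ∘ (φ_j, t))` on `(0,1)^{m+1}`, bound the dimension of the complement of
  `W = ⋃ (φ_j ∗ θ)(V)` by `m`, parametrize `V` and `(0,1)^{m+1} ∖ W` by `familyParam`,
  reparametrize `f ∘ ω` on the small pieces by `UR(k, ℓ)`, pad by projections and
  renormalize on the subdivision grid.

Nothing here is a named fact; no definitions.

## References

* N. Bhardwaj, L. van den Dries, *On the Pila–Wilkie theorem*, Expo. Math. 40 (2022), §7
  (proof of `(I)_{m+1}`), Cor. 7.1. [BhardwajVanDenDries2022]
* J. Pila, A. J. Wilkie, *The rational points of a definable set*, Duke Math. J. 133 (2006),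
  §4 (Lemma 4.2, Cor. 4.3), §5 (Cor. 5.1). [PilaWilkie2006]
-/

noncomputable section

open Set FirstOrder FirstOrder.Language Filter Topology Function

namespace Literature.ModelTheory.ExponentialFields

/-! ### Tools for the assembly of `(I)_{m+1}` (Bhardwaj–van den Dries 2022, §7) -/

section S7Tools

variable {L : FirstOrder.Language.{0, 0}} [L.Structure ℝ]

/-- Local notation: the open unit cube `(0,1)^ℓ`. -/
local notation "𝕀^" ℓ:max => (Set.pi Set.univ fun _ : Fin ℓ => Set.Ioo (0 : ℝ) 1)

/-- **Padding charts by a coordinate projection** (`λ̂(t₁,…,t_{M}) = λ(t₁,…,t_ℓ)` in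
Bhardwaj–van den Dries 2022, §7): precomposition with the projection `(0,1)^M → (0,1)^ℓ`,
`ℓ ≤ M`, onto the first `ℓ` coordinates preserves `C^r` and the derivative bounds.
[cite: BhardwajVanDenDries2022, §7] -/
theorem contDiffOn_norm_iteratedFDeriv_comp_proj {ℓ M r : ℕ} (hℓ : ℓ ≤ M) {h : (Fin ℓ → ℝ) → ℝ} {C : ℝ}
    (hh : ContDiffOn ℝ r h (𝕀^ℓ))
    (hb : ∀ q ≤ r, ∀ y ∈ 𝕀^ℓ, ‖iteratedFDeriv ℝ q h y‖ ≤ C) :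
    ContDiffOn ℝ r (fun z : Fin M → ℝ => h (fun i => z (Fin.castLE hℓ i))) (𝕀^M) ∧
      ∀ q ≤ r, ∀ z ∈ 𝕀^M, ‖iteratedFDeriv ℝ q (fun z : Fin M → ℝ => h (fun i => z (Fin.castLE hℓ i))) z‖ ≤ C := by
  set P : (Fin M → ℝ) →L[ℝ] (Fin ℓ → ℝ) :=
    ContinuousLinearMap.pi fun i : Fin ℓ => ContinuousLinearMap.proj (R := ℝ) (Fin.castLE hℓ i) with hP
  have hPapply : ∀ z, P z = fun i => z (Fin.castLE hℓ i) := fun z => by ext i; rfl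
  have hcomp : (fun z : Fin M → ℝ => h (fun i => z (Fin.castLE hℓ i))) = h ∘ P := by
    funext z; simp only [Function.comp_apply, hPapply]
  have hopen : IsOpen (𝕀^ℓ) := isOpen_set_pi finite_univ fun _ _ => isOpen_Ioo
  have hsub : (𝕀^M) ⊆ P ⁻¹' 𝕀^ℓ := fun z hz => by
    show P z ∈ 𝕀^ℓ
    rw [hPapply]; exact fun i _ => hz _ (mem_univ _)
  have hPn : ‖P‖ ≤ 1 := by
    refine ContinuousLinearMap.opNorm_le_bound _ zero_le_one fun z => ?_
    rw [one_mul, hPapply, pi_norm_le_iff_of_nonneg (norm_nonneg _)]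
    intro i
    exact norm_le_pi_norm z _
  have hCr : ContDiffOn ℝ r (fun z : Fin M → ℝ => h (fun i => z (Fin.castLE hℓ i))) (𝕀^M) := by
    rw [hcomp]
    exact hh.comp P.contDiff.contDiffOn (fun z hz => hsub hz)
  refine ⟨hCr, fun q hq z hz => ?_⟩
  have hpre : IsOpen (P ⁻¹' 𝕀^ℓ) := hopen.preimage P.continuous
  have hzpre : z ∈ P ⁻¹' 𝕀^ℓ := hsub hz
  rw [← iteratedFDerivWithin_of_isOpen q hpre hzpre, hcomp]
  have hcr := P.iteratedFDerivWithin_comp_right hh hopen.uniqueDiffOn hpre.uniqueDiffOn hzpre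
    (i := q) (by exact_mod_cast hq)
  rw [hcr]
  calc ‖(iteratedFDerivWithin ℝ q h (𝕀^ℓ) (P z)).compContinuousLinearMap fun _ => P‖
      ≤ ‖iteratedFDerivWithin ℝ q h (𝕀^ℓ) (P z)‖ * ∏ _i : Fin q, ‖P‖ :=
        ContinuousMultilinearMap.norm_compContinuousLinearMap_le _ _
    _ ≤ C * 1 := by
        have hC : 0 ≤ C := (norm_nonneg _).trans (hb 0 (Nat.zero_le _) (P z) hzpre)
        apply mul_le_mul _ (Finset.prod_le_one (fun _ _ => norm_nonneg _) fun _ _ => hPn)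
          (Finset.prod_nonneg fun _ _ => norm_nonneg _) hC
        rw [iteratedFDerivWithin_of_isOpen q hopen hzpre]
        exact hb q hq (P z) hzpre
    _ = C := mul_one C

/-- The projection onto the first `ℓ ≤ M` coordinates maps the cube onto the cube. [folklore] -/
theorem proj_castLE_surjOn {ℓ M : ℕ} (hℓ : ℓ ≤ M) :
    SurjOn (fun z : Fin M → ℝ => fun i => z (Fin.castLE hℓ i)) (𝕀^M) (𝕀^ℓ) := by
  intro y hy
  refine ⟨fun j => if h : (j : ℕ) < ℓ then y ⟨j, h⟩ else 1 / 2, fun j _ => ?_, ?_⟩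
  · simp only
    split_ifs with h
    · exact hy _ (mem_univ _)
    · constructor <;> norm_num
  · funext i
    simp [Fin.castLE]

/-- The projection maps the cube into the cube. [folklore] -/
theorem proj_castLE_mapsTo {ℓ M : ℕ} (hℓ : ℓ ≤ M) :
    MapsTo (fun z : Fin M → ℝ => fun i => z (Fin.castLE hℓ i)) (𝕀^M) (𝕀^ℓ) :=
  fun _ hz _ _ => hz _ (mem_univ _)

/-- Constant charts have vanishing higher derivatives and are harmless members of a
parametrization. [folklore] -/
theorem norm_iteratedFDeriv_const_le {M : ℕ} (c : ℝ) (hc : |c| ≤ 1) (q : ℕ) (z : Fin M → ℝ) :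
    ‖iteratedFDeriv ℝ q (fun _ : Fin M → ℝ => c) z‖ ≤ 1 := by
  rcases q with _ | q
  · simpa using hc
  · rw [iteratedFDeriv_const_of_ne (by omega)]; simp

/-- A definable subset of `ℝ^M`, `M ≥ 1`, with empty interior has dimension `< M`.
[folklore] -/
theorem dim_lt_of_interior_eq_empty {M : ℕ} (hM : 1 ≤ M) (hO : L.IsOMinimal ℝ)
    (hlt : (univ : Set ℝ).Definable L {v : Fin 2 → ℝ | v 0 < v 1})
    {X : Set (Fin M → ℝ)} (hX : (univ : Set ℝ).Definable L X) (hint : interior X = ∅) :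
    CellDimension.dim L M X < M := by
  rcases X.eq_empty_or_nonempty with h | hne
  · rw [h, CellDimension.dim_eq_zero_of_forall_not fun ι' C' hC' hsub => ?_]
    · exact hM
    · exact absurd (subset_empty_iff.mp hsub) hC'.nonempty.ne_empty
  · rcases (CellDimension.dim_le (L := L) X).lt_or_eq with h | h
    · exact h
    · have := CellDimension.interior_nonempty_of_dim_eq hO hlt hX hne h
      rw [hint] at this
      exact absurd this not_nonempty_empty

/-- The slice `{y ∈ (0,1)^{m+1} | y_{m+1} = t}` has dimension `≤ m` (it is the image of
`(0,1)^m` under `y' ↦ (y', t)`). [folklore] -/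
theorem dim_slice_le {m : ℕ} (hO : L.IsOMinimal ℝ)
    (hadd : (univ : Set ℝ).Definable L {v : Fin 3 → ℝ | v 0 + v 1 = v 2})
    (hmul : (univ : Set ℝ).Definable L {v : Fin 3 → ℝ | v 0 * v 1 = v 2}) (t : ℝ) :
    CellDimension.dim L (m + 1) {y : Fin (m + 1) → ℝ | y ∈ 𝕀^(m + 1) ∧ y (Fin.last m) = t} ≤ m := by
  have hlt := definable_lt_of_field hadd hmul
  have hmap : (univ : Set ℝ).DefinableMap L (fun y' : Fin m → ℝ => (Fin.snoc y' t : Fin (m + 1) → ℝ)) := by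
    intro l
    refine Fin.lastCases ?_ (fun j => ?_) l
    · simp only [Fin.snoc_last]; exact definableFun_const' _ _
    · simp only [Fin.snoc_castSucc]; exact definableFun_proj _
  have hcube : (univ : Set ℝ).Definable L (𝕀^m : Set (Fin m → ℝ)) := by
    have h := definable_iInter_of_finite (L := L) (A := (univ : Set ℝ))
      (f := fun i : Fin m => {x : Fin m → ℝ | 0 < x i ∧ x i < 1})
      (fun i => definable_setOf_and (definable_setOf_lt hlt (definableFun_const' _ _) (definableFun_proj _))
        (definable_setOf_lt hlt (definableFun_proj _) (definableFun_const' _ _)))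
    convert h using 1
    ext x; simp [Set.mem_pi]
  have hsub : {y : Fin (m + 1) → ℝ | y ∈ 𝕀^(m + 1) ∧ y (Fin.last m) = t} ⊆
      (fun y' : Fin m → ℝ => (Fin.snoc y' t : Fin (m + 1) → ℝ)) '' 𝕀^m := by
    rintro y ⟨hy, hyt⟩
    refine ⟨Fin.init y, fun j _ => hy (Fin.castSucc j) (mem_univ _), ?_⟩
    rw [← hyt]; exact Fin.snoc_init_self y
  calc CellDimension.dim L (m + 1) {y : Fin (m + 1) → ℝ | y ∈ 𝕀^(m + 1) ∧ y (Fin.last m) = t}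
      ≤ CellDimension.dim L (m + 1) ((fun y' : Fin m → ℝ => (Fin.snoc y' t : Fin (m + 1) → ℝ)) '' 𝕀^m) :=
        CellDimension.dim_mono hsub
    _ ≤ CellDimension.dim L m (𝕀^m : Set (Fin m → ℝ)) := CellDimension.dim_image_le hO hlt hmap hcube
    _ ≤ m := CellDimension.dim_le _

end S7Tools

/-! ### `(I)_{m+1}`: the uniform reparametrization in dimension `m + 1` (Bhardwaj–van den Dries 2022, §7) -/

section Succ

open Classical

variable {L : FirstOrder.Language.{0, 0}} [L.Structure ℝ]

/-- Local notation: the open unit cube `(0,1)^ℓ`. -/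
local notation "𝕀^" ℓ:max => (Set.pi Set.univ fun _ : Fin ℓ => Set.Ioo (0 : ℝ) 1)

/-- **`(I)_{m+1}` from `(I)_{≤ m}`, uniformly in parameters over `ℝ`** (Bhardwaj–van den Dries
2022, §7, proof of `(I)_{m+1}`; Pila–Wilkie 2006, §4–§5): the uniform `k`-reparametrization
property `UR(k, ℓ)` for all `ℓ ≤ m` implies `UR(k, m + 1)`.  Proof as printed: reparametrize
the sections `f^t` uniformly in `(v, t)` by `UR(k, m)`; apply Cor. 6.4 (`lastVariable_Ck`) to
`F = (φ_j, f ∘ (φ_j, t))` on `U = (0,1)^{m+1}`; the maps `φ_j ∗ θ` cover `(0,1)^{m+1}` off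
`W`'s complement of dimension `≤ m`; parametrize `V` and `(0,1)^{m+1} ∖ W` by the uniform
strong parametrization (`familyParam`, which uses `UR(k, ℓ)`, `ℓ ≤ m`), reparametrize `f ∘ θ`
on the small pieces by `UR(k, ℓ)`, pad by coordinate projections, and renormalize all bounds
to `1` on a subdivision grid. [cite: BhardwajVanDenDries2022, §7] [cite: PilaWilkie2006, Lemma 4.2, Cor. 5.1] -/
theorem uniformReparam_succ {m k : ℕ} (hO : L.IsOMinimal ℝ)
    (hadd : (univ : Set ℝ).Definable L {v : Fin 3 → ℝ | v 0 + v 1 = v 2})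
    (hmul : (univ : Set ℝ).Definable L {v : Fin 3 → ℝ | v 0 * v 1 = v 2}) (hk : 1 ≤ k)
    (hUR : ∀ ℓ, ℓ ≤ m → ∀ (n mp : ℕ) (F : Fin n → (Fin mp → ℝ) → (Fin ℓ → ℝ) → ℝ),
      (∀ l, IsDefinableFamily L (F l)) → (∀ l v, ∀ x ∈ 𝕀^ℓ, |F l v x| ≤ 1) →
      ∃ (κ : Type) (_ : Fintype κ) (ψ : κ → (Fin mp → ℝ) → (Fin ℓ → ℝ) → (Fin ℓ → ℝ)),
        (∀ j c, IsDefinableFamily L (fun v x => ψ j v x c)) ∧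
        ∀ v, (∀ j, MapsTo (ψ j v) (𝕀^ℓ) (𝕀^ℓ)) ∧ (⋃ j, ψ j v '' 𝕀^ℓ) = 𝕀^ℓ ∧
          (∀ j c, ContDiffOn ℝ k (fun x => ψ j v x c) (𝕀^ℓ)) ∧
          (∀ j c, ∀ q ≤ k, ∀ x ∈ 𝕀^ℓ, ‖iteratedFDeriv ℝ q (fun x => ψ j v x c) x‖ ≤ 1) ∧
          (∀ j l, ContDiffOn ℝ k (fun x => F l v (ψ j v x)) (𝕀^ℓ)) ∧
          (∀ j l, ∀ q ≤ k, ∀ x ∈ 𝕀^ℓ, ‖iteratedFDeriv ℝ q (fun x => F l v (ψ j v x)) x‖ ≤ 1))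
    (n mp : ℕ) (F : Fin n → (Fin mp → ℝ) → (Fin (m + 1) → ℝ) → ℝ)
    (hF : ∀ l, IsDefinableFamily L (F l)) (hbd : ∀ l v, ∀ x ∈ 𝕀^(m + 1), |F l v x| ≤ 1) :
    ∃ (κ : Type) (_ : Fintype κ) (ψ : κ → (Fin mp → ℝ) → (Fin (m + 1) → ℝ) → (Fin (m + 1) → ℝ)),
      (∀ j c, IsDefinableFamily L (fun v x => ψ j v x c)) ∧
      ∀ v, (∀ j, MapsTo (ψ j v) (𝕀^(m + 1)) (𝕀^(m + 1))) ∧ (⋃ j, ψ j v '' 𝕀^(m + 1)) = 𝕀^(m + 1) ∧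
        (∀ j c, ContDiffOn ℝ k (fun x => ψ j v x c) (𝕀^(m + 1))) ∧
        (∀ j c, ∀ q ≤ k, ∀ x ∈ 𝕀^(m + 1), ‖iteratedFDeriv ℝ q (fun x => ψ j v x c) x‖ ≤ 1) ∧
        (∀ j l, ContDiffOn ℝ k (fun x => F l v (ψ j v x)) (𝕀^(m + 1))) ∧
        (∀ j l, ∀ q ≤ k, ∀ x ∈ 𝕀^(m + 1), ‖iteratedFDeriv ℝ q (fun x => F l v (ψ j v x)) x‖ ≤ 1) := by
  have hlt := definable_lt_of_field hadd hmul
  have hIo : ∀ ℓ, IsOpen (𝕀^ℓ : Set (Fin ℓ → ℝ)) := fun ℓ => isOpen_set_pi finite_univ fun _ _ => isOpen_Ioo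
  ----------------------------------------------------------------- (U1) reparametrize the sections, uniformly in `(v, t)`
  set Fsec : Fin n → (Fin (mp + 1) → ℝ) → (Fin m → ℝ) → ℝ := fun l w y =>
    max (-1) (min 1 (F l (Fin.init w) (Fin.snoc y (w (Fin.last mp))))) with hFsec
  have hFsecdef : ∀ l, IsDefinableFamily L (Fsec l) := by
    intro l γ _ qm Tm hqm hTm
    refine definableFun_clamp hlt ((hF l).definableFun (fun a => hqm _) (fun b => ?_))
    refine Fin.lastCases ?_ (fun j => ?_) b
    · simp only [Fin.snoc_last]; exact hqm _
    · simp only [Fin.snoc_castSucc]; exact hTm _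
  have hFsecbd : ∀ l w, ∀ y ∈ 𝕀^m, |Fsec l w y| ≤ 1 := fun l w y _ => abs_clamp_le _
  have hFsec_eq : ∀ l (v : Fin mp → ℝ) (t : ℝ), t ∈ Ioo (0 : ℝ) 1 → ∀ y ∈ 𝕀^m,
      Fsec l (Fin.snoc v t) y = F l v (Fin.snoc y t) := by
    intro l v t ht y hy
    simp only [hFsec, Fin.init_snoc, Fin.snoc_last]
    refine clamp_eq_self (hbd l v _ fun i _ => ?_)
    refine Fin.lastCases ?_ (fun j => ?_) i
    · simp only [Fin.snoc_last]; exact ht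
    · simp only [Fin.snoc_castSucc]; exact hy j (mem_univ _)
  obtain ⟨κ, hκ, φ, hφdef, hφ⟩ := hUR m le_rfl n (mp + 1) Fsec hFsecdef hFsecbd
  ----------------------------------------------------------------- (U2) Cor. 6.4 for `F = (φ_j, f ∘ (φ_j, t))` on `(0,1)^{m+1}`
  -- coordinates of a total point `u = (v, (y, t))`
  set vOf : (Fin (mp + (m + 1)) → ℝ) → Fin mp → ℝ := fun u a => u (Fin.castAdd (m + 1) a) with hvOf
  set xOf : (Fin (mp + (m + 1)) → ℝ) → Fin (m + 1) → ℝ := fun u b => u (Fin.natAdd mp b) with hxOf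
  set wOf : (Fin (mp + (m + 1)) → ℝ) → Fin (mp + 1) → ℝ := fun u => Fin.snoc (vOf u) (xOf u (Fin.last m)) with hwOf
  set yOf : (Fin (mp + (m + 1)) → ℝ) → Fin m → ℝ := fun u => Fin.init (xOf u) with hyOf
  have hvOfdef : (univ : Set ℝ).DefinableMap L vOf := fun a => definableFun_proj _
  have hxOfdef : (univ : Set ℝ).DefinableMap L xOf := fun b => definableFun_proj _
  have hwOfdef : (univ : Set ℝ).DefinableMap L wOf := by
    intro a
    refine Fin.lastCases ?_ (fun j => ?_) a
    · simp only [hwOf, Fin.snoc_last]; exact definableFun_proj _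
    · simp only [hwOf, Fin.snoc_castSucc]; exact definableFun_proj _
  have hyOfdef : (univ : Set ℝ).DefinableMap L yOf := fun j => definableFun_proj _
  have hOf_append : ∀ (v : Fin mp → ℝ) (x : Fin (m + 1) → ℝ),
      vOf (Fin.append v x) = v ∧ xOf (Fin.append v x) = x := fun v x =>
    ⟨funext fun a => by simp [hvOf], funext fun b => by simp [hxOf]⟩
  set C₂ : Type := κ × (Fin m ⊕ Fin n) with hC₂
  set fC : C₂ → (Fin (mp + (m + 1)) → ℝ) → ℝ := fun c u =>
    Sum.elim (fun i => φ c.1 (wOf u) (yOf u) i) (fun l => Fsec l (wOf u) (φ c.1 (wOf u) (yOf u))) c.2 with hfC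
  have hφmapdef : ∀ j, (univ : Set ℝ).DefinableMap L (fun u => φ j (wOf u) (yOf u)) := fun j i =>
    (hφdef j i).definableFun hwOfdef hyOfdef
  have hfCdef : ∀ c, (univ : Set ℝ).DefinableFun L (fC c) := by
    rintro ⟨j, i | l⟩
    · exact (hφdef j i).definableFun hwOfdef hyOfdef
    · exact (hFsecdef l).definableFun hwOfdef (hφmapdef j)
  set N₂ : ℕ := Fintype.card C₂ with hN₂
  set eC : C₂ ≃ Fin N₂ := Fintype.equivFin C₂ with heC
  set fN : Fin N₂ → (Fin (mp + (m + 1)) → ℝ) → ℝ := fun c' => fC (eC.symm c') with hfN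
  set Ucube : Set (Fin (mp + (m + 1)) → ℝ) := {u | xOf u ∈ 𝕀^(m + 1)} with hUcube
  have hUcubedef : (univ : Set ℝ).Definable L Ucube := by
    have h := definable_iInter_of_finite (L := L) (A := (univ : Set ℝ))
      (f := fun b : Fin (m + 1) => {u : Fin (mp + (m + 1)) → ℝ | 0 < xOf u b ∧ xOf u b < 1})
      (fun b => definable_setOf_and (definable_setOf_lt hlt (definableFun_const' _ _) (hxOfdef b))
        (definable_setOf_lt hlt (hxOfdef b) (definableFun_const' _ _)))
    convert h using 1
    ext u; simp [hUcube, Set.mem_pi]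
  have hUfib : ∀ v : Fin mp → ℝ, {x : Fin (m + 1) → ℝ | (Fin.append v x :) ∈ Ucube} = 𝕀^(m + 1) := by
    intro v; ext x; simp only [hUcube, mem_setOf_eq, (hOf_append v x).2]
  -- the sections of the `fC`
  have hsec : ∀ (c : C₂) (v : Fin mp → ℝ) (t : ℝ) (y : Fin m → ℝ),
      fC c (Fin.append v (Fin.snoc y t)) =
        Sum.elim (fun i => φ c.1 (Fin.snoc v t) y i) (fun l => Fsec l (Fin.snoc v t) (φ c.1 (Fin.snoc v t) y)) c.2 := by
    intro c v t y
    have hw : wOf (Fin.append v (Fin.snoc y t)) = Fin.snoc v t := by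
      simp only [hwOf, (hOf_append v _).1, (hOf_append v _).2, Fin.snoc_last]
    have hy : yOf (Fin.append v (Fin.snoc y t)) = y := by
      simp only [hyOf, (hOf_append v _).2, Fin.init_snoc]
    simp only [hfC, hw, hy]
  have hsecfib : ∀ (v : Fin mp → ℝ) (t : ℝ), {y : Fin m → ℝ | (Fin.append v (Fin.snoc y t) :) ∈ Ucube} ⊆ 𝕀^m := by
    intro v t y hy
    have h : xOf (Fin.append v (Fin.snoc y t)) ∈ 𝕀^(m + 1) := hy
    rw [(hOf_append v _).2] at h
    exact fun j _ => by simpa using h (Fin.castSucc j) (mem_univ _)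
  have hsecCk : ∀ (c' : Fin N₂) (v : Fin mp → ℝ) (t : ℝ),
      ContDiffOn ℝ k (fun y : Fin m → ℝ => fN c' (Fin.append v (Fin.snoc y t))) {y | (Fin.append v (Fin.snoc y t) :) ∈ Ucube} := by
    intro c' v t
    set c := eC.symm c' with hc
    have heq : (fun y : Fin m → ℝ => fN c' (Fin.append v (Fin.snoc y t))) =
        fun y => Sum.elim (fun i => φ c.1 (Fin.snoc v t) y i) (fun l => Fsec l (Fin.snoc v t) (φ c.1 (Fin.snoc v t) y)) c.2 := by
      funext y; exact hsec c v t y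
    rw [heq]
    refine ContDiffOn.mono ?_ (hsecfib v t)
    rcases c with ⟨j, i | l⟩
    · exact (hφ (Fin.snoc v t)).2.2.1 j i
    · exact (hφ (Fin.snoc v t)).2.2.2.2.1 j l
  have hsecbd : ∀ (c' : Fin N₂) (v : Fin mp → ℝ) (t : ℝ), ∀ y : Fin m → ℝ, (Fin.append v (Fin.snoc y t) :) ∈ Ucube →
      ∀ q ≤ k, ‖iteratedFDeriv ℝ q (fun y : Fin m → ℝ => fN c' (Fin.append v (Fin.snoc y t))) y‖ ≤ 1 := by
    intro c' v t y hy q hq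
    set c := eC.symm c' with hc
    have heq : (fun y : Fin m → ℝ => fN c' (Fin.append v (Fin.snoc y t))) =
        fun y => Sum.elim (fun i => φ c.1 (Fin.snoc v t) y i) (fun l => Fsec l (Fin.snoc v t) (φ c.1 (Fin.snoc v t) y)) c.2 := by
      funext y; exact hsec c v t y
    rw [heq]
    have hy' : y ∈ 𝕀^m := hsecfib v t hy
    rcases c with ⟨j, i | l⟩
    · exact (hφ (Fin.snoc v t)).2.2.2.1 j i q hq y hy'
    · exact (hφ (Fin.snoc v t)).2.2.2.2.2 j l q hq y hy'
  obtain ⟨Kθ, hKθ, θ, V, Cθ, Bk, hCθ, hBk, hθdef, hVdef, hP⟩ := lastVariable_Ck (p := mp) (m := m) (n := N₂) (k := k)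
    hO hadd hmul hk Ucube hUcubedef (fun v => by rw [hUfib]; exact hIo _) (fun v => (hUfib v).le)
    (fun v => by rw [hUfib, sdiff_self]; exact interior_empty) fN (fun c' => hfCdef _) (B := 1)
    hsecCk hsecbd k le_rfl
  ----------------------------------------------------------------- (G1) the maps `φ_j ∗ θ`, the set `W` and its complement
  -- unpacked facts from Cor. 6.4 at a parameter
  have hVU : ∀ v, {x : Fin (m + 1) → ℝ | (Fin.append v x :) ∈ V} ⊆ 𝕀^(m + 1) := fun v => by
    rw [← hUfib v]; exact (hP v).2.2.2.2.2.1
  have hVopen : ∀ v, IsOpen {x : Fin (m + 1) → ℝ | (Fin.append v x :) ∈ V} := fun v => (hP v).2.2.2.2.2.2.1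
  have hVbig : ∀ v, interior (𝕀^(m + 1) \ {x : Fin (m + 1) → ℝ | (Fin.append v x :) ∈ V}) = ∅ := fun v => by
    rw [← hUfib v]; exact (hP v).2.2.2.2.2.2.2.1
  have hθmaps : ∀ jθ v, MapsTo (θ jθ v) (Ioo 0 1) (Ioo 0 1) := fun jθ v => (hP v).2.1 jθ
  have hθCk : ∀ jθ v, ContDiffOn ℝ k (θ jθ v) (Ioo 0 1) := fun jθ v => (hP v).2.2.1 jθ
  have hθbd : ∀ jθ v, ∀ i ≤ k, ∀ t ∈ Ioo (0 : ℝ) 1, |iteratedDerivWithin i (θ jθ v) (Ioo 0 1) t| ≤ Cθ := fun jθ v => (hP v).2.2.2.1 jθ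
  have hθcof : ∀ v, (Ioo (0 : ℝ) 1 \ ⋃ jθ, θ jθ v '' Ioo 0 1).Finite := fun v => (hP v).2.2.2.2.1
  -- `Φfun j jθ v x = (φ_j^{θ(t)}(x'), θ(t))`
  set Φfun : κ → Kθ → (Fin mp → ℝ) → (Fin (m + 1) → ℝ) → Fin (m + 1) → ℝ := fun j jθ v x =>
    Fin.snoc (φ j (Fin.snoc v (θ jθ v (x (Fin.last m)))) (Fin.init x)) (θ jθ v (x (Fin.last m))) with hΦfun
  -- the coordinate families of `Φfun`
  have hΦcoord : ∀ j jθ (c : Fin (m + 1)) {γ : Type} [Finite γ] (qm : (γ → ℝ) → Fin mp → ℝ) (Tm : (γ → ℝ) → Fin (m + 1) → ℝ),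
      (univ : Set ℝ).DefinableMap L qm → (univ : Set ℝ).DefinableMap L Tm →
      (univ : Set ℝ).DefinableFun L (fun e => Φfun j jθ (qm e) (Tm e) c) := by
    intro j jθ c γ _ qm Tm hqm hTm
    have hθe : (univ : Set ℝ).DefinableFun L (fun e => θ jθ (qm e) (Tm e (Fin.last m))) :=
      (hθdef jθ).definableFun hqm (hTm _)
    refine Fin.lastCases ?_ (fun i => ?_) c
    · simp only [hΦfun, Fin.snoc_last]; exact hθe
    · simp only [hΦfun, Fin.snoc_castSucc]
      refine (hφdef j i).definableFun (q := fun e => Fin.snoc (qm e) (θ jθ (qm e) (Tm e (Fin.last m))))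
        (T := fun e => Fin.init (Tm e)) (fun a => ?_) (fun b => hTm _)
      refine Fin.lastCases ?_ (fun a' => ?_) a
      · simp only [Fin.snoc_last]; exact hθe
      · simp only [Fin.snoc_castSucc]; exact hqm _
  -- `W = ⋃ Φfun(V)` as a definable family
  set Wset : Set (Fin (mp + (m + 1)) → ℝ) := {u | ∃ x : Fin (m + 1) → ℝ, (Fin.append (vOf u) x :) ∈ V ∧
      ∃ jj : κ × Kθ, Φfun jj.1 jj.2 (vOf u) x = xOf u} with hWset
  have hWsetdef : (univ : Set ℝ).Definable L Wset := by
    apply definable_setOf_exists_block' (β := Fin (m + 1)) (α := Fin (mp + (m + 1)))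
    refine definable_setOf_and ?_ ?_
    · refine hVdef.preimage_map (fun l' => ?_)
      refine Fin.addCases (fun a => ?_) (fun b => ?_) l'
      · simp only [Fin.append_left]; exact definableFun_proj _
      · simp only [Fin.append_right]; exact definableFun_proj _
    · have h := definable_iUnion_of_finite (L := L) (A := (univ : Set ℝ))
        (f := fun jj : κ × Kθ => {g : Fin (mp + (m + 1)) ⊕ Fin (m + 1) → ℝ |
          ∀ c : Fin (m + 1), Φfun jj.1 jj.2 (fun a => g (Sum.inl (Fin.castAdd (m + 1) a))) (fun b => g (Sum.inr b)) c =
            g (Sum.inl (Fin.natAdd mp c))})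
        (fun jj => by
          have h' := definable_iInter_of_finite (L := L) (A := (univ : Set ℝ))
            (f := fun c : Fin (m + 1) => {g : Fin (mp + (m + 1)) ⊕ Fin (m + 1) → ℝ |
              Φfun jj.1 jj.2 (fun a => g (Sum.inl (Fin.castAdd (m + 1) a))) (fun b => g (Sum.inr b)) c =
                g (Sum.inl (Fin.natAdd mp c))})
            (fun c => definable_setOf_eq' (hΦcoord jj.1 jj.2 c _ _ (fun a => definableFun_proj _) (fun b => definableFun_proj _))
              (definableFun_proj _))
          convert h' using 1; ext g; simp only [mem_iInter, mem_setOf_eq])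
      convert h using 1
      ext g
      simp only [mem_iUnion, mem_setOf_eq, hvOf, hxOf]
      constructor
      · rintro ⟨jj, hjj⟩; exact ⟨jj, fun c => congrFun hjj c⟩
      · rintro ⟨jj, hjj⟩; exact ⟨jj, funext hjj⟩
  set Z₂ : Set (Fin (mp + (m + 1)) → ℝ) := {u | xOf u ∈ 𝕀^(m + 1) ∧ u ∉ Wset} with hZ₂
  have hZ₂def : (univ : Set ℝ).Definable L Z₂ := hUcubedef.inter hWsetdef.compl
  have hWfib : ∀ v (y : Fin (m + 1) → ℝ), (Fin.append v y :) ∈ Wset ↔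
      ∃ x : Fin (m + 1) → ℝ, (Fin.append v x :) ∈ V ∧ ∃ jj : κ × Kθ, Φfun jj.1 jj.2 v x = y := by
    intro v y; simp only [hWset, mem_setOf_eq, (hOf_append v y).1, (hOf_append v y).2]
  have hZ₂fib : ∀ v (y : Fin (m + 1) → ℝ), (Fin.append v y :) ∈ Z₂ ↔ y ∈ 𝕀^(m + 1) ∧ (Fin.append v y :) ∉ Wset := by
    intro v y; simp only [hZ₂, mem_setOf_eq, (hOf_append v y).2]
  have hZ₂sub : ∀ v, {y : Fin (m + 1) → ℝ | (Fin.append v y :) ∈ Z₂} ⊆ 𝕀^(m + 1) := fun v y hy => ((hZ₂fib v y).mp hy).1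
  ----------------------------------------------------------------- (U5) `dim ((0,1)^{m+1} ∖ W_v) ≤ m`
  have hΦmapdef : ∀ j jθ v, (univ : Set ℝ).DefinableMap L (Φfun j jθ v) := fun j jθ v c =>
    hΦcoord j jθ c (fun _ => v) (fun x => x) (fun a => definableFun_const' _ _) (fun b => definableFun_proj _)
  have hdimZ₂ : ∀ v, CellDimension.dim L (m + 1) {y : Fin (m + 1) → ℝ | (Fin.append v y :) ∈ Z₂} ≤ m := by
    intro v
    set Eθ : Set ℝ := Ioo (0 : ℝ) 1 \ ⋃ jθ, θ jθ v '' Ioo 0 1 with hEθ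
    have hEfin : Eθ.Finite := hθcof v
    set S₁ : Set (Fin (m + 1) → ℝ) := ⋃ t ∈ hEfin.toFinset, {y | y ∈ 𝕀^(m + 1) ∧ y (Fin.last m) = t} with hS₁
    set S₂ : Set (Fin (m + 1) → ℝ) := ⋃ jj ∈ (Finset.univ : Finset (κ × Kθ)),
      Φfun jj.1 jj.2 v '' (𝕀^(m + 1) \ {x | (Fin.append v x :) ∈ V}) with hS₂
    have hsub : {y : Fin (m + 1) → ℝ | (Fin.append v y :) ∈ Z₂} ⊆ S₁ ∪ S₂ := by
      intro y hy
      obtain ⟨hyI, hyW⟩ := (hZ₂fib v y).mp hy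
      by_cases ht : y (Fin.last m) ∈ Eθ
      · exact Or.inl (mem_iUnion₂.mpr ⟨y (Fin.last m), hEfin.mem_toFinset.mpr ht, hyI, rfl⟩)
      · right
        -- `t = θ(s)`, `y' = φ_j^{t}(x')`
        have htI : y (Fin.last m) ∈ Ioo (0 : ℝ) 1 := hyI (Fin.last m) (mem_univ _)
        have htcov : y (Fin.last m) ∈ ⋃ jθ, θ jθ v '' Ioo 0 1 := by
          by_contra h; exact ht ⟨htI, h⟩
        obtain ⟨jθ, s, hs, hst⟩ := by simpa only [mem_iUnion, mem_image] using htcov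
        have hy'I : Fin.init y ∈ 𝕀^m := fun i _ => hyI (Fin.castSucc i) (mem_univ _)
        have hcov := (hφ (Fin.snoc v (y (Fin.last m)))).2.1
        have hy'cov : Fin.init y ∈ ⋃ j, φ j (Fin.snoc v (y (Fin.last m))) '' 𝕀^m := by rw [hcov]; exact hy'I
        obtain ⟨j, x', hx', hx'y⟩ := by simpa only [mem_iUnion, mem_image] using hy'cov
        set x : Fin (m + 1) → ℝ := Fin.snoc x' s with hx
        have hxI : x ∈ 𝕀^(m + 1) := fun i _ => by
          refine Fin.lastCases ?_ (fun i' => ?_) i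
          · simp only [hx, Fin.snoc_last]; exact hs
          · simp only [hx, Fin.snoc_castSucc]; exact hx' i' (mem_univ _)
        have hΦx : Φfun j jθ v x = y := by
          simp only [hΦfun, hx, Fin.snoc_last, Fin.init_snoc, hst, hx'y, Fin.snoc_init_self]
        have hxV : x ∉ {x : Fin (m + 1) → ℝ | (Fin.append v x :) ∈ V} := fun hxV =>
          hyW ((hWfib v y).mpr ⟨x, hxV, (j, jθ), hΦx⟩)
        exact mem_iUnion₂.mpr ⟨(j, jθ), Finset.mem_univ _, x, ⟨hxI, hxV⟩, hΦx⟩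
    have hcube' : (univ : Set ℝ).Definable L (𝕀^(m + 1) : Set (Fin (m + 1) → ℝ)) := by
      have := definable_fibre_append hUcubedef v; rwa [hUfib v] at this
    have hS₁def : ∀ t, (univ : Set ℝ).Definable L {y : Fin (m + 1) → ℝ | y ∈ 𝕀^(m + 1) ∧ y (Fin.last m) = t} := fun t =>
      hcube'.inter (definable_setOf_eq' (definableFun_proj _) (definableFun_const' _ _))
    have hS₂def : ∀ jj : κ × Kθ, (univ : Set ℝ).Definable L (Φfun jj.1 jj.2 v '' (𝕀^(m + 1) \ {x | (Fin.append v x :) ∈ V})) :=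
      fun jj => CellDimension.definable_image (hcube'.sdiff (definable_fibre_append hVdef v)) (hΦmapdef jj.1 jj.2 v)
    have hdim1 : CellDimension.dim L (m + 1) S₁ ≤ m := by
      rw [hS₁, CellDimension.dim_biUnion_finset hO hlt _ _ (fun t _ => hS₁def t)]
      exact Finset.sup_le fun t _ => dim_slice_le hO hadd hmul t
    have hdim2 : CellDimension.dim L (m + 1) S₂ ≤ m := by
      rw [hS₂, CellDimension.dim_biUnion_finset hO hlt _ _ (fun jj _ => hS₂def jj)]
      refine Finset.sup_le fun jj _ => ?_
      have h1 := CellDimension.dim_image_le hO hlt (hΦmapdef jj.1 jj.2 v) (hcube'.sdiff (definable_fibre_append hVdef v))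
      have h2 := dim_lt_of_interior_eq_empty (M := m + 1) (Nat.succ_pos m) hO hlt (hcube'.sdiff (definable_fibre_append hVdef v)) (hVbig v)
      exact Nat.lt_succ_iff.mp (lt_of_le_of_lt h1 h2)
    have hS₁d : (univ : Set ℝ).Definable L S₁ := by
      rw [hS₁]; exact Set.definable_biUnion_finset (fun t => hS₁def t) _
    have hS₂d : (univ : Set ℝ).Definable L S₂ := by
      rw [hS₂]; exact Set.definable_biUnion_finset (fun jj => hS₂def jj) _
    calc CellDimension.dim L (m + 1) {y : Fin (m + 1) → ℝ | (Fin.append v y :) ∈ Z₂}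
        ≤ CellDimension.dim L (m + 1) (S₁ ∪ S₂) := CellDimension.dim_mono hsub
      _ = max (CellDimension.dim L (m + 1) S₁) (CellDimension.dim L (m + 1) S₂) := CellDimension.dim_union hO hlt hS₁d hS₂d
      _ ≤ m := max_le hdim1 hdim2
  ----------------------------------------------------------------- (G2) strong parametrizations of `V` and of `(0,1)^{m+1} ∖ W`
  obtain ⟨κ₁, hκ₁, ℓ₁, A₁, χ, hℓ₁, hA₁def, hχdef, hχ⟩ :=
    familyParam (p := mp) (M := m + 1) (r := k) hO hadd hmul (fun ℓ hℓ => hUR ℓ (by omega)) V hVdef hVU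
  obtain ⟨κ₂, hκ₂, ℓ₂, A₂, ω, hℓ₂, hA₂def, hωdef, hω⟩ :=
    familyParam (p := mp) (M := m + 1) (r := k) hO hadd hmul (fun ℓ hℓ => hUR ℓ (by omega)) Z₂ hZ₂def hZ₂sub
  ----------------------------------------------------------------- (G3) reparametrizing `f ∘ ω` on the pieces of dimension `≤ m`
  -- the clamped families on `(0,1)^{ℓ₂ b}`: coordinates of `ω_b` and `F_l ∘ ω_b`
  set Fω : ∀ b : κ₂, Fin (m + 1 + n) → (Fin mp → ℝ) → (Fin (ℓ₂ b) → ℝ) → ℝ := fun b =>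
    Fin.addCases (fun c v z => max (-1) (min 1 (ω b v z c)))
      (fun l v z => max (-1) (min 1 (F l v (fun c => max (-1) (min 1 (ω b v z c)))))) with hFω
  have hFωdef : ∀ b l', IsDefinableFamily L (Fω b l') := by
    intro b l'
    refine Fin.addCases (fun c => ?_) (fun l => ?_) l'
    · simp only [hFω, Fin.addCases_left]
      intro γ _ qm Tm hqm hTm
      exact definableFun_clamp hlt ((hωdef b c).definableFun hqm hTm)
    · simp only [hFω, Fin.addCases_right]
      intro γ _ qm Tm hqm hTm
      exact definableFun_clamp hlt ((hF l).definableFun hqm fun c => definableFun_clamp hlt ((hωdef b c).definableFun hqm hTm))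
  have hFωbd : ∀ b l' v, ∀ z ∈ 𝕀^(ℓ₂ b), |Fω b l' v z| ≤ 1 := by
    intro b l' v z _
    refine Fin.addCases (fun c => ?_) (fun l => ?_) l'
    · simp only [hFω, Fin.addCases_left]; exact abs_clamp_le _
    · simp only [hFω, Fin.addCases_right]; exact abs_clamp_le _
  have hΛ : ∀ b : κ₂, ∃ (κΛ : Type) (_ : Fintype κΛ) (lam : κΛ → (Fin mp → ℝ) → (Fin (ℓ₂ b) → ℝ) → (Fin (ℓ₂ b) → ℝ)),
      (∀ i c, IsDefinableFamily L (fun v z => lam i v z c)) ∧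
      (ℓ₂ b ≤ m → ∀ v, (∀ i, MapsTo (lam i v) (𝕀^(ℓ₂ b)) (𝕀^(ℓ₂ b))) ∧ (⋃ i, lam i v '' 𝕀^(ℓ₂ b)) = 𝕀^(ℓ₂ b) ∧
        (∀ i c, ContDiffOn ℝ k (fun z => lam i v z c) (𝕀^(ℓ₂ b))) ∧
        (∀ i c, ∀ q ≤ k, ∀ z ∈ 𝕀^(ℓ₂ b), ‖iteratedFDeriv ℝ q (fun z => lam i v z c) z‖ ≤ 1) ∧
        (∀ i l', ContDiffOn ℝ k (fun z => Fω b l' v (lam i v z)) (𝕀^(ℓ₂ b))) ∧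
        (∀ i l', ∀ q ≤ k, ∀ z ∈ 𝕀^(ℓ₂ b), ‖iteratedFDeriv ℝ q (fun z => Fω b l' v (lam i v z)) z‖ ≤ 1)) := by
    intro b
    by_cases hb : ℓ₂ b ≤ m
    · obtain ⟨κΛ, hκΛ, lam, hlamdef, hlam⟩ := hUR (ℓ₂ b) hb (m + 1 + n) mp (Fω b) (hFωdef b) (hFωbd b)
      exact ⟨κΛ, hκΛ, lam, hlamdef, fun _ => hlam⟩
    · refine ⟨Unit, inferInstance, fun _ _ z => z, fun _ c γ _ qm Tm _ hTm => hTm c, fun h => absurd h hb⟩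
  choose κΛ hκΛ lam hlamdef hlam using hΛ
  ----------------------------------------------------------------- (G4) constants, projections, grid
  -- iterated derivatives of functions agreeing on an open set
  have hFDcongr : ∀ {M : ℕ} {O : Set (Fin M → ℝ)} (_ : IsOpen O) {f₁ f₂ : (Fin M → ℝ) → ℝ} (_ : EqOn f₁ f₂ O) {x} (_ : x ∈ O) (q : ℕ),
      iteratedFDeriv ℝ q f₁ x = iteratedFDeriv ℝ q f₂ x := by
    intro M O hO' f₁ f₂ heq x hx q
    exact ((heq.eventuallyEq_of_mem (hO'.mem_nhds hx)).iteratedFDeriv ℝ q).eq_of_nhds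
  set B₁ : ℝ := max (((m + 1 : ℕ) : ℝ) ^ k * Bk) Cθ with hB₁
  have hB₁1 : 1 ≤ B₁ := le_max_of_le_right hCθ
  set Ctot : ℝ := (k.factorial : ℝ) * B₁ with hCtot
  have hkf1 : (1 : ℝ) ≤ k.factorial := by exact_mod_cast Nat.one_le_iff_ne_zero.mpr (Nat.factorial_ne_zero k)
  have hCtot1 : 1 ≤ Ctot := by rw [hCtot]; nlinarith
  have hB₁C : B₁ ≤ Ctot := by rw [hCtot]; nlinarith
  set Kg : ℕ := ⌈Ctot⌉₊ with hKg
  have hCK : Ctot ≤ Kg := Nat.le_ceil Ctot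
  have hKg1 : 1 ≤ Kg := by have : (1 : ℝ) ≤ Kg := hCtot1.trans hCK; exact_mod_cast this
  have hK0 : (0 : ℝ) < Kg := by
    have : (1 : ℝ) ≤ Kg := by exact_mod_cast hKg1
    linarith
  obtain ⟨hAmaps, hAcov⟩ := subdivision_grid (ℓ := m + 1) hKg1
  -- projections
  set proj : ∀ ℓ : ℕ, ℓ ≤ m + 1 → (Fin (m + 1) → ℝ) → Fin ℓ → ℝ := fun ℓ hℓ x i => x (Fin.castLE hℓ i) with hproj
  have hprojdef : ∀ ℓ (hℓ : ℓ ≤ m + 1) {γ : Type} [Finite γ] (Tm : (γ → ℝ) → Fin (m + 1) → ℝ),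
      (univ : Set ℝ).DefinableMap L Tm → (univ : Set ℝ).DefinableMap L (fun e => proj ℓ hℓ (Tm e)) :=
    fun ℓ hℓ γ _ Tm hTm i => hTm _
  ----------------------------------------------------------------- (G5) the charts before renormalization
  set cst : (Fin (m + 1) → ℝ) := fun _ => 1 / 2 with hcst
  have hcstI : cst ∈ 𝕀^(m + 1) := fun _ _ => by simp only [hcst]; constructor <;> norm_num
  set preA : κ × Kθ × κ₁ → (Fin mp → ℝ) → (Fin (m + 1) → ℝ) → Fin (m + 1) → ℝ := fun idx v x =>
    if A₁ idx.2.2 v then Φfun idx.1 idx.2.1 v (χ idx.2.2 v (proj (ℓ₁ idx.2.2) (hℓ₁ idx.2.2) x)) else cst with hpreA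
  set preB : (Σ b : κ₂, κΛ b) → (Fin mp → ℝ) → (Fin (m + 1) → ℝ) → Fin (m + 1) → ℝ := fun idx v x =>
    if A₂ idx.1 v then fun c => max (-1) (min 1 (ω idx.1 v (lam idx.1 idx.2 v (proj (ℓ₂ idx.1) (hℓ₂ idx.1) x)) c)) else cst with hpreB
  set pre : (κ × Kθ × κ₁) ⊕ (Σ b : κ₂, κΛ b) → (Fin mp → ℝ) → (Fin (m + 1) → ℝ) → Fin (m + 1) → ℝ :=
    Sum.elim preA preB with hpre
  set Ψ : ((κ × Kθ × κ₁) ⊕ (Σ b : κ₂, κΛ b)) × (Fin (m + 1) → Fin (2 * Kg - 1)) → (Fin mp → ℝ) →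
      (Fin (m + 1) → ℝ) → Fin (m + 1) → ℝ := fun ia v x =>
    pre ia.1 v ((fun i => ((ia.2 i : ℕ) : ℝ) / (2 * Kg)) + (1 / Kg : ℝ) • x) with hΨ
  -- definability
  have haffdef : ∀ (a : Fin (m + 1) → Fin (2 * Kg - 1)) {γ : Type} [Finite γ] (Tm : (γ → ℝ) → Fin (m + 1) → ℝ),
      (univ : Set ℝ).DefinableMap L Tm →
      (univ : Set ℝ).DefinableMap L (fun e => (fun i => ((a i : ℕ) : ℝ) / (2 * Kg)) + (1 / Kg : ℝ) • Tm e) := by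
    intro a γ _ Tm hTm i
    simp only [Pi.add_apply, Pi.smul_apply, smul_eq_mul]
    exact definableFun_add hadd (definableFun_const' _ _) (definableFun_mul hmul (definableFun_const' _ _) (hTm i))
  have hpredef : ∀ idx c, IsDefinableFamily L (fun v x => pre idx v x c) := by
    rintro (⟨j, jθ, a⟩ | ⟨b, i⟩) c γ _ qm Tm hqm hTm
    · simp only [hpre, Sum.elim_inl, hpreA]
      have hcond : (univ : Set ℝ).Definable L (setOf fun e : γ → ℝ => A₁ a (qm e)) := (hA₁def a).preimage_map hqm
      have h1 : (univ : Set ℝ).DefinableFun L (fun e => Φfun j jθ (qm e) (χ a (qm e) (proj (ℓ₁ a) (hℓ₁ a) (Tm e))) c) :=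
        hΦcoord j jθ c qm _ hqm (fun c' => (hχdef a c').definableFun hqm (hprojdef _ _ Tm hTm))
      have h2 : (univ : Set ℝ).DefinableFun L (fun _ : γ → ℝ => cst c) := definableFun_const' _ _
      convert Set.DefinableFun.ite hcond h1 h2 using 2 with e
      split_ifs <;> rfl
    · simp only [hpre, Sum.elim_inr, hpreB]
      have hcond : (univ : Set ℝ).Definable L (setOf fun e : γ → ℝ => A₂ b (qm e)) := (hA₂def b).preimage_map hqm
      have hlm : (univ : Set ℝ).DefinableMap L (fun e => lam b i (qm e) (proj (ℓ₂ b) (hℓ₂ b) (Tm e))) :=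
        fun c' => (hlamdef b i c').definableFun hqm (hprojdef _ _ Tm hTm)
      have h1 : (univ : Set ℝ).DefinableFun L (fun e => max (-1) (min 1 (ω b (qm e) (lam b i (qm e) (proj (ℓ₂ b) (hℓ₂ b) (Tm e))) c))) :=
        definableFun_clamp hlt ((hωdef b c).definableFun hqm hlm)
      have h2 : (univ : Set ℝ).DefinableFun L (fun _ : γ → ℝ => cst c) := definableFun_const' _ _
      convert Set.DefinableFun.ite hcond h1 h2 using 2 with e
      split_ifs <;> rfl
  have hΨdef : ∀ ia c, IsDefinableFamily L (fun v x => Ψ ia v x c) := by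
    rintro ⟨idx, a⟩ c γ _ qm Tm hqm hTm
    exact (hpredef idx c).definableFun hqm (haffdef a Tm hTm)
  refine ⟨((κ × Kθ × κ₁) ⊕ (Σ b : κ₂, κΛ b)) × (Fin (m + 1) → Fin (2 * Kg - 1)), inferInstance, Ψ, hΨdef, fun v => ?_⟩
  ----------------------------------------------------------------- at a parameter `v`
  set Vv : Set (Fin (m + 1) → ℝ) := {x | (Fin.append v x :) ∈ V} with hVv
  obtain ⟨-, -, -, -, -, -, -, -, hjθ⟩ := hP v
  -- the functions of Cor. 6.4 attached to `(j, jθ)` and their identification with `Φfun`, `F ∘ Φfun`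
  have hinit_update : ∀ (y : Fin (m + 1) → ℝ) (s : ℝ), Fin.init (Function.update y (Fin.last m) s) = Fin.init y := by
    intro y s; ext i; simp [Fin.init]
  have hfCA : ∀ j jθ (i : Fin m) (y : Fin (m + 1) → ℝ),
      fN (eC (j, Sum.inl i)) (Fin.append v (Function.update y (Fin.last m) (θ jθ v (y (Fin.last m))))) =
        Φfun j jθ v y (Fin.castSucc i) := by
    intro j jθ i y
    simp only [hfN, Equiv.symm_apply_apply, hfC, hwOf, hyOf, (hOf_append v _).1, (hOf_append v _).2,
      Function.update_self, hinit_update, hΦfun, Fin.snoc_castSucc, Sum.elim_inl]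
  have hfCF : ∀ j jθ (l : Fin n), ∀ y ∈ Vv,
      fN (eC (j, Sum.inr l)) (Fin.append v (Function.update y (Fin.last m) (θ jθ v (y (Fin.last m))))) =
        F l v (Φfun j jθ v y) := by
    intro j jθ l y hy
    have hyI : y ∈ 𝕀^(m + 1) := hVU v hy
    have ht : θ jθ v (y (Fin.last m)) ∈ Ioo (0 : ℝ) 1 := hθmaps jθ v (hyI (Fin.last m) (mem_univ _))
    have hy' : Fin.init y ∈ 𝕀^m := fun i _ => hyI (Fin.castSucc i) (mem_univ _)
    have hφI : φ j (Fin.snoc v (θ jθ v (y (Fin.last m)))) (Fin.init y) ∈ 𝕀^m := (hφ _).1 j hy'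
    simp only [hfN, Equiv.symm_apply_apply, hfC, hwOf, hyOf, (hOf_append v _).1, (hOf_append v _).2,
      Function.update_self, hinit_update, Sum.elim_inr]
    rw [hFsec_eq l v _ ht _ hφI]
  -- Fréchet bounds on `V_v`
  have hVvopen : IsOpen Vv := hVopen v
  have hboundA : ∀ j jθ (c : Fin (m + 1)), ContDiffOn ℝ k (fun y => Φfun j jθ v y c) Vv ∧
      ∀ q ≤ k, ∀ y ∈ Vv, ‖iteratedFDeriv ℝ q (fun y => Φfun j jθ v y c) y‖ ≤ B₁ := by
    intro j jθ c
    refine Fin.lastCases ?_ (fun i => ?_) c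
    · -- the last coordinate `θ(y_{m+1})`
      obtain ⟨hc, hb⟩ := contDiffOn_norm_iteratedFDeriv_comp_coord (n := m + 1) (r := k) (Fin.last m) (hθCk jθ v) (hθbd jθ v)
      have heq : (fun y : Fin (m + 1) → ℝ => Φfun j jθ v y (Fin.last m)) = fun y => θ jθ v (y (Fin.last m)) := by
        funext y; simp only [hΦfun, Fin.snoc_last]
      rw [heq]
      exact ⟨hc.mono (hVU v), fun q hq y hy => (hb q hq y (hVU v hy)).trans (le_max_right _ _)⟩
    · obtain ⟨-, hCk, hwb⟩ := hjθ jθ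
      have hCk' := hCk (eC (j, Sum.inl i))
      have heq : (fun y => fN (eC (j, Sum.inl i)) (Fin.append v (Function.update y (Fin.last m) (θ jθ v (y (Fin.last m)))))) =
          fun y => Φfun j jθ v y (Fin.castSucc i) := funext (hfCA j jθ i)
      rw [heq] at hCk'
      refine ⟨hCk', fun q hq y hy => ?_⟩
      have hb := norm_iteratedFDeriv_le_of_pderivWord hVvopen (hCk'.of_le (by exact_mod_cast hq)) hy (M := Bk) (by linarith)
        fun r => by
          have h := hwb (eC (j, Sum.inl i)) y hy (List.ofFn r) (by simp; omega) (by
            refine (List.count_le_length).trans ?_; simp; omega)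
          rwa [heq] at h
      refine hb.trans ((le_max_left _ _).trans' ?_)
      have h1 : ((m + 1 : ℕ) : ℝ) ^ q ≤ ((m + 1 : ℕ) : ℝ) ^ k :=
        pow_le_pow_right₀ (by exact_mod_cast Nat.one_le_iff_ne_zero.mpr (Nat.succ_ne_zero m)) hq
      have h2 : (0 : ℝ) ≤ Bk := by linarith
      push_cast at h1 ⊢
      nlinarith
  have hboundF : ∀ j jθ (l : Fin n), ContDiffOn ℝ k (fun y => F l v (Φfun j jθ v y)) Vv ∧
      ∀ q ≤ k, ∀ y ∈ Vv, ‖iteratedFDeriv ℝ q (fun y => F l v (Φfun j jθ v y)) y‖ ≤ B₁ := by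
    intro j jθ l
    obtain ⟨-, hCk, hwb⟩ := hjθ jθ
    have hCk' := hCk (eC (j, Sum.inr l))
    have heq : EqOn (fun y => fN (eC (j, Sum.inr l)) (Fin.append v (Function.update y (Fin.last m) (θ jθ v (y (Fin.last m))))))
        (fun y => F l v (Φfun j jθ v y)) Vv := fun y hy => hfCF j jθ l y hy
    refine ⟨hCk'.congr fun y hy => (heq hy).symm, fun q hq y hy => ?_⟩
    rw [← hFDcongr hVvopen heq hy q]
    have hb := norm_iteratedFDeriv_le_of_pderivWord hVvopen (hCk'.of_le (by exact_mod_cast hq)) hy (M := Bk) (by linarith)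
      fun r => hwb (eC (j, Sum.inr l)) y hy (List.ofFn r) (by simp; omega) (by
          refine (List.count_le_length).trans ?_; simp; omega)
    refine hb.trans ((le_max_left _ _).trans' ?_)
    have h1 : ((m + 1 : ℕ) : ℝ) ^ q ≤ ((m + 1 : ℕ) : ℝ) ^ k :=
      pow_le_pow_right₀ (by exact_mod_cast Nat.one_le_iff_ne_zero.mpr (Nat.succ_ne_zero m)) hq
    have h2 : (0 : ℝ) ≤ Bk := by linarith
    push_cast at h1 ⊢
    nlinarith
  have hΦmapsV : ∀ j jθ, MapsTo (Φfun j jθ v) Vv (𝕀^(m + 1)) := by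
    intro j jθ y hy c _
    have hyI : y ∈ 𝕀^(m + 1) := hVU v hy
    refine Fin.lastCases ?_ (fun i => ?_) c
    · simp only [hΦfun, Fin.snoc_last]; exact hθmaps jθ v (hyI (Fin.last m) (mem_univ _))
    · simp only [hΦfun, Fin.snoc_castSucc]
      exact (hφ _).1 j (fun i' _ => hyI (Fin.castSucc i') (mem_univ _)) i (mem_univ _)
  ----------------------------------------------------------------- properties of the charts before renormalization
  have hpreprop : ∀ idx, MapsTo (pre idx v) (𝕀^(m + 1)) (𝕀^(m + 1)) ∧
      (∀ c, ContDiffOn ℝ k (fun x => pre idx v x c) (𝕀^(m + 1)) ∧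
        ∀ q ≤ k, ∀ x ∈ 𝕀^(m + 1), ‖iteratedFDeriv ℝ q (fun x => pre idx v x c) x‖ ≤ Ctot) ∧
      (∀ l, ContDiffOn ℝ k (fun x => F l v (pre idx v x)) (𝕀^(m + 1)) ∧
        ∀ q ≤ k, ∀ x ∈ 𝕀^(m + 1), ‖iteratedFDeriv ℝ q (fun x => F l v (pre idx v x)) x‖ ≤ Ctot) := by
    -- constants
    have hconst : MapsTo (fun _ : Fin (m + 1) → ℝ => cst) (𝕀^(m + 1)) (𝕀^(m + 1)) ∧
        (∀ c, ContDiffOn ℝ k (fun _ : Fin (m + 1) → ℝ => cst c) (𝕀^(m + 1)) ∧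
          ∀ q ≤ k, ∀ x ∈ 𝕀^(m + 1), ‖iteratedFDeriv ℝ q (fun _ : Fin (m + 1) → ℝ => cst c) x‖ ≤ Ctot) ∧
        (∀ l, ContDiffOn ℝ k (fun _ : Fin (m + 1) → ℝ => F l v cst) (𝕀^(m + 1)) ∧
          ∀ q ≤ k, ∀ x ∈ 𝕀^(m + 1), ‖iteratedFDeriv ℝ q (fun _ : Fin (m + 1) → ℝ => F l v cst) x‖ ≤ Ctot) := by
      refine ⟨fun _ _ => hcstI, fun c => ⟨contDiffOn_const, fun q _ x _ => ?_⟩, fun l => ⟨contDiffOn_const, fun q _ x _ => ?_⟩⟩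
      · exact (norm_iteratedFDeriv_const_le (cst c) (by simp only [hcst]; rw [abs_le]; constructor <;> norm_num) q x).trans hCtot1
      · exact (norm_iteratedFDeriv_const_le (F l v cst) (hbd l v cst hcstI) q x).trans hCtot1
    rintro (⟨j, jθ, a⟩ | ⟨b, i⟩)
    · ----------------------------------------------------------- type A
      by_cases hA : A₁ a v
      · have hpre_eq : pre (Sum.inl (j, jθ, a)) v = fun x => Φfun j jθ v (χ a v (proj (ℓ₁ a) (hℓ₁ a) x)) := by
          funext x; simp only [hpre, Sum.elim_inl, hpreA, hA, if_true]
        rw [hpre_eq]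
        obtain ⟨hχmaps, hχCk, hχbd, -⟩ := (hχ v).2 a hA
        have hχmaps' : MapsTo (χ a v) (𝕀^(ℓ₁ a)) Vv := hχmaps
        -- composition with `χ` then with the projection
        have hcompA : ∀ (H : (Fin (m + 1) → ℝ) → ℝ), ContDiffOn ℝ k H Vv →
            (∀ q ≤ k, ∀ y ∈ Vv, ‖iteratedFDeriv ℝ q H y‖ ≤ B₁) →
            ContDiffOn ℝ k (fun x : Fin (m + 1) → ℝ => H (χ a v (proj (ℓ₁ a) (hℓ₁ a) x))) (𝕀^(m + 1)) ∧
              ∀ q ≤ k, ∀ x ∈ 𝕀^(m + 1), ‖iteratedFDeriv ℝ q (fun x : Fin (m + 1) → ℝ => H (χ a v (proj (ℓ₁ a) (hℓ₁ a) x))) x‖ ≤ Ctot := by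
          intro H hH hHb
          obtain ⟨h1, h2⟩ := contDiffOn_norm_iteratedFDeriv_comp_open (ℓ := ℓ₁ a) (r := k) hVvopen zero_le_one hH hHb hχCk hχmaps'
            (fun c q _ hq z hz => by rw [one_pow]; exact hχbd c q hq z hz)
          obtain ⟨h3, h4⟩ := contDiffOn_norm_iteratedFDeriv_comp_proj (hℓ₁ a) (r := k) (C := Ctot) h1
            (fun q hq z hz => (h2 q hq z hz).trans (by
              rw [one_pow, mul_one, hCtot]
              have : (q.factorial : ℝ) ≤ k.factorial := by exact_mod_cast Nat.factorial_le hq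
              nlinarith))
          exact ⟨h3, h4⟩
        refine ⟨fun x hx => hΦmapsV j jθ (hχmaps' (proj_castLE_mapsTo (hℓ₁ a) hx)), fun c => ?_, fun l => ?_⟩
        · exact hcompA _ (hboundA j jθ c).1 (hboundA j jθ c).2
        · exact hcompA _ (hboundF j jθ l).1 (hboundF j jθ l).2
      · have hpre_eq : pre (Sum.inl (j, jθ, a)) v = fun _ => cst := by
          funext x; simp only [hpre, Sum.elim_inl, hpreA, hA, if_false]
        rw [hpre_eq]; exact hconst
    · ----------------------------------------------------------- type B
      by_cases hA : A₂ b v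
      · have hpre_eq : pre (Sum.inr ⟨b, i⟩) v =
            fun x c => max (-1) (min 1 (ω b v (lam b i v (proj (ℓ₂ b) (hℓ₂ b) x)) c)) := by
          funext x; simp only [hpre, Sum.elim_inr, hpreB, hA, if_true]
        rw [hpre_eq]
        obtain ⟨hωmaps, -, -, hℓdim⟩ := (hω v).2 b hA
        have hb : ℓ₂ b ≤ m := hℓdim.trans (hdimZ₂ v)
        obtain ⟨hlmaps, -, hlCk, hlbd, hFlCk, hFlbd⟩ := hlam b hb v
        -- values: the clamps are inactive and the chart lands in `Z₂ ⊆ (0,1)^{m+1}`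
        have hval : ∀ x ∈ 𝕀^(m + 1), ∀ c,
            max (-1) (min 1 (ω b v (lam b i v (proj (ℓ₂ b) (hℓ₂ b) x)) c)) = ω b v (lam b i v (proj (ℓ₂ b) (hℓ₂ b) x)) c ∧
            ω b v (lam b i v (proj (ℓ₂ b) (hℓ₂ b) x)) ∈ 𝕀^(m + 1) := by
          intro x hx c
          have hz : lam b i v (proj (ℓ₂ b) (hℓ₂ b) x) ∈ 𝕀^(ℓ₂ b) := hlmaps i (proj_castLE_mapsTo (hℓ₂ b) hx)
          have hωI : ω b v (lam b i v (proj (ℓ₂ b) (hℓ₂ b) x)) ∈ 𝕀^(m + 1) := hZ₂sub v (hωmaps hz)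
          have hc := hωI c (mem_univ _)
          exact ⟨clamp_eq_self (by rw [abs_le]; exact ⟨by linarith [hc.1], hc.2.le⟩), hωI⟩
        have hmapsB : MapsTo (fun x c => max (-1) (min 1 (ω b v (lam b i v (proj (ℓ₂ b) (hℓ₂ b) x)) c))) (𝕀^(m + 1)) (𝕀^(m + 1)) := by
          intro x hx c _
          show max (-1) (min 1 (ω b v (lam b i v (proj (ℓ₂ b) (hℓ₂ b) x)) c)) ∈ Ioo (0 : ℝ) 1
          rw [(hval x hx c).1]; exact (hval x hx c).2 c (mem_univ _)
        refine ⟨hmapsB, fun c => ?_, fun l => ?_⟩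
        · -- coordinates: `Fω b (castAdd n c) ∘ lam`, padded
          have heq : (fun z => Fω b (Fin.castAdd n c) v (lam b i v z)) = fun z => max (-1) (min 1 (ω b v (lam b i v z) c)) := by
            funext z; simp only [hFω, Fin.addCases_left]
          have h1 := hFlCk i (Fin.castAdd n c)
          have h2 := hFlbd i (Fin.castAdd n c)
          rw [heq] at h1 h2
          obtain ⟨h3, h4⟩ := contDiffOn_norm_iteratedFDeriv_comp_proj (hℓ₂ b) (r := k) (C := 1) h1 h2
          exact ⟨h3, fun q hq x hx => (h4 q hq x hx).trans hCtot1⟩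
        · -- compositions: `Fω b (natAdd (m+1) l) ∘ lam`, padded, agrees with `F l ∘ pre` on the cube
          have heq : (fun z => Fω b (Fin.natAdd (m + 1) l) v (lam b i v z)) =
              fun z => max (-1) (min 1 (F l v (fun c => max (-1) (min 1 (ω b v (lam b i v z) c))))) := by
            funext z; simp only [hFω, Fin.addCases_right]
          have h1 := hFlCk i (Fin.natAdd (m + 1) l)
          have h2 := hFlbd i (Fin.natAdd (m + 1) l)
          rw [heq] at h1 h2
          obtain ⟨h3, h4⟩ := contDiffOn_norm_iteratedFDeriv_comp_proj (hℓ₂ b) (r := k) (C := 1) h1 h2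
          have hEq : EqOn (fun x : Fin (m + 1) → ℝ => max (-1) (min 1 (F l v (fun c => max (-1) (min 1 (ω b v (lam b i v (proj (ℓ₂ b) (hℓ₂ b) x)) c))))))
              (fun x => F l v (fun c => max (-1) (min 1 (ω b v (lam b i v (proj (ℓ₂ b) (hℓ₂ b) x)) c)))) (𝕀^(m + 1)) :=
            fun x hx => clamp_eq_self (hbd l v _ (hmapsB hx))
          refine ⟨h3.congr fun x hx => (hEq hx).symm, fun q hq x hx => ?_⟩
          rw [← hFDcongr (hIo _) hEq hx q]
          exact (h4 q hq x hx).trans hCtot1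
      · have hpre_eq : pre (Sum.inr ⟨b, i⟩) v = fun _ => cst := by
          funext x; simp only [hpre, Sum.elim_inr, hpreB, hA, if_false]
        rw [hpre_eq]; exact hconst
  ----------------------------------------------------------------- covering before renormalization
  have hprecov : (𝕀^(m + 1) : Set (Fin (m + 1) → ℝ)) ⊆ ⋃ idx, pre idx v '' 𝕀^(m + 1) := by
    intro y hy
    by_cases hyW : (Fin.append v y :) ∈ Wset
    · obtain ⟨x, hxV, ⟨j, jθ⟩, hxy⟩ := (hWfib v y).mp hyW
      have hxcov : x ∈ ⋃ a, ⋃ (_ : A₁ a v), χ a v '' 𝕀^(ℓ₁ a) := by rw [← (hχ v).1]; exact hxV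
      obtain ⟨a, hA, z, hz, hzx⟩ := by simpa only [mem_iUnion, mem_image, exists_prop] using hxcov
      obtain ⟨x₁, hx₁, hx₁z⟩ := proj_castLE_surjOn (hℓ₁ a) hz
      refine mem_iUnion.mpr ⟨Sum.inl (j, jθ, a), x₁, hx₁, ?_⟩
      simp only [hpre, Sum.elim_inl, hpreA, hA, if_true]
      rw [show proj (ℓ₁ a) (hℓ₁ a) x₁ = z from hx₁z, hzx, hxy]
    · have hyZ : (Fin.append v y :) ∈ Z₂ := (hZ₂fib v y).mpr ⟨hy, hyW⟩
      have hycov : y ∈ ⋃ b, ⋃ (_ : A₂ b v), ω b v '' 𝕀^(ℓ₂ b) := by rw [← (hω v).1]; exact hyZ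
      obtain ⟨b, hA, z, hz, hzy⟩ := by simpa only [mem_iUnion, mem_image, exists_prop] using hycov
      have hb : ℓ₂ b ≤ m := ((hω v).2 b hA).2.2.2.trans (hdimZ₂ v)
      obtain ⟨hlmaps, hlcov, -⟩ := hlam b hb v
      have hzcov : z ∈ ⋃ i, lam b i v '' 𝕀^(ℓ₂ b) := by rw [hlcov]; exact hz
      obtain ⟨i, z', hz', hz'z⟩ := by simpa only [mem_iUnion, mem_image] using hzcov
      obtain ⟨x₁, hx₁, hx₁z⟩ := proj_castLE_surjOn (hℓ₂ b) hz'
      refine mem_iUnion.mpr ⟨Sum.inr ⟨b, i⟩, x₁, hx₁, ?_⟩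
      simp only [hpre, Sum.elim_inr, hpreB, hA, if_true]
      rw [show proj (ℓ₂ b) (hℓ₂ b) x₁ = z' from hx₁z, hz'z, hzy]
      funext c
      have hc := hy c (mem_univ _)
      exact clamp_eq_self (by rw [abs_le]; exact ⟨by linarith [hc.1], hc.2.le⟩)
  ----------------------------------------------------------------- renormalization
  have hall : ∀ ia, MapsTo (Ψ ia v) (𝕀^(m + 1)) (𝕀^(m + 1)) ∧
      (∀ c, ContDiffOn ℝ k (fun x => Ψ ia v x c) (𝕀^(m + 1))) ∧
      (∀ c, ∀ q ≤ k, ∀ x ∈ 𝕀^(m + 1), ‖iteratedFDeriv ℝ q (fun x => Ψ ia v x c) x‖ ≤ 1) ∧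
      (∀ l, ContDiffOn ℝ k (fun x => F l v (Ψ ia v x)) (𝕀^(m + 1))) ∧
      (∀ l, ∀ q ≤ k, ∀ x ∈ 𝕀^(m + 1), ‖iteratedFDeriv ℝ q (fun x => F l v (Ψ ia v x)) x‖ ≤ 1) := by
    rintro ⟨idx, a⟩
    obtain ⟨hmaps, hcoord, hcomp⟩ := hpreprop idx
    have hmapsΨ : MapsTo (Ψ ⟨idx, a⟩ v) (𝕀^(m + 1)) (𝕀^(m + 1)) := fun x hx => hmaps (hAmaps a hx)
    -- the renormalization estimate
    have hren : ∀ (G : (Fin (m + 1) → ℝ) → ℝ), ContDiffOn ℝ k G (𝕀^(m + 1)) →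
        (∀ q ≤ k, ∀ x ∈ 𝕀^(m + 1), ‖iteratedFDeriv ℝ q G x‖ ≤ Ctot) → (∀ x ∈ 𝕀^(m + 1), |G x| ≤ 1) →
        ContDiffOn ℝ k (fun x => G ((fun i => ((a i : ℕ) : ℝ) / (2 * Kg)) + (1 / Kg : ℝ) • x)) (𝕀^(m + 1)) ∧
          ∀ q ≤ k, ∀ x ∈ 𝕀^(m + 1), ‖iteratedFDeriv ℝ q (fun x => G ((fun i => ((a i : ℕ) : ℝ) / (2 * Kg)) + (1 / Kg : ℝ) • x)) x‖ ≤ 1 := by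
      intro G hG hGb hGv
      obtain ⟨h1, h2⟩ := norm_iteratedFDeriv_comp_affine_le (r := k) (fun i => ((a i : ℕ) : ℝ) / (2 * Kg)) (1 / Kg : ℝ) hG hGb (hAmaps a)
      refine ⟨h1, fun q hq x hx => ?_⟩
      rcases Nat.eq_zero_or_pos q with rfl | hq1
      · rw [norm_iteratedFDeriv_zero, Real.norm_eq_abs]; exact hGv _ (hAmaps a hx)
      · refine (h2 q hq x hx).trans ?_
        rw [abs_of_pos (by positivity : (0 : ℝ) < 1 / Kg)]
        calc Ctot * (1 / Kg) ^ q ≤ Kg * (1 / Kg) ^ 1 := by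
              apply mul_le_mul hCK _ (by positivity) hK0.le
              exact pow_le_pow_of_le_one (by positivity) ((div_le_one hK0).mpr (by exact_mod_cast hKg1)) hq1
          _ = 1 := by field_simp
    refine ⟨hmapsΨ, fun c => ?_, fun c => ?_, fun l => ?_, fun l => ?_⟩
    · exact (hren _ (hcoord c).1 (hcoord c).2 fun x hx => by
        have h := hmaps hx c (mem_univ _); rw [abs_le]; exact ⟨by linarith [h.1], h.2.le⟩).1
    · exact (hren _ (hcoord c).1 (hcoord c).2 fun x hx => by
        have h := hmaps hx c (mem_univ _); rw [abs_le]; exact ⟨by linarith [h.1], h.2.le⟩).2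
    · exact (hren _ (hcomp l).1 (hcomp l).2 fun x hx => hbd l v _ (hmaps hx)).1
    · exact (hren _ (hcomp l).1 (hcomp l).2 fun x hx => hbd l v _ (hmaps hx)).2
  refine ⟨fun ia => (hall ia).1, ?_, fun ia c => (hall ia).2.1 c, fun ia c => (hall ia).2.2.1 c,
    fun ia l => (hall ia).2.2.2.1 l, fun ia l => (hall ia).2.2.2.2 l⟩
  -- covering
  apply Subset.antisymm
  · exact iUnion_subset fun ia => (hall ia).1.image_subset
  · intro y hy
    obtain ⟨idx, x, hx, hxy⟩ := by simpa only [mem_iUnion, mem_image] using hprecov hy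
    obtain ⟨a, x₀, hx₀, hx₀x⟩ := hAcov x hx
    refine mem_iUnion.mpr ⟨⟨idx, a⟩, x₀, hx₀, ?_⟩
    simp only [hΨ]
    rw [hx₀x, hxy]

end Succ


end Literature.ModelTheory.ExponentialFields

end
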